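import Summits.ValiantsHypothesis.ValiantsHypothesis.Theorems.SymPencilPerFourToricEqualSplit
import Summits.ValiantsHypothesis.ValiantsHypothesis.Theorems.SymPencilPerFourToricSingleRow

/-!
# Route `SymPencil` — the toric case at dimension `6`, VII: two rows with the same image
# (`--supports` stmt-ValiantsHypothesis-5674; crux workfile `Cruxes/SdcSuperquadratic/TORIC-SIX.md`)

`W` `6`-dimensional with H3, all row ranks `2`, column ranks `≤ 2`, rows `q ≠ q'` with the same
image `L`.  **Theorem** (`false_of_rows_eq`): impossible.  With `X = W ∩ {rows q, q' = 0}`: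
`dim X = 4` is `SymPencilPerFourToricEqualSplit`; if `dim X ≤ 3` some `y² ∈ W` has row `q` zero
and row `q'` equal to `u₂ ≠ 0`, the columns of `supp u₂` are dead on `X` (else column rank `3`,
`L` being live there in row `q` too) and the pair lever with `u₂` kills the other subpermanents of
`X`, so `dim X ≤ 2` (`SymPencilPerFourToricTwoRow`); then rows `q, q'` are jointly free, `X` is
dead at every live column of `L`, and two / one / zero dead columns of `L` die by the H3 product
identity `y_{p̃k} · per = 0` / the unit `E_{pk}` making `L ⊥ L` / `X = 0`.  Honest framing: one case
of the toric case of `R6`; nothing here changes `sdc(per_4) ≥ 25`; the crux `SdcSuperquadratic`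
and `VP ≠ VNP` are untouched.  No definitions, no named facts. [folklore]
-/

noncomputable section

-- single-conjunct layout: Sub = Summit, duplicated namespace component intended
set_option linter.dupNamespace false

namespace Summit.ValiantsHypothesis.ValiantsHypothesis.Theorems.SymPencilPerFourToricEqualRows

open Matrix Finset Module
open Literature.Computability.AlgebraicComplexity
open Literature.Computability.AlgebraicComplexity.AlperBogartVelasco
open Summit.ValiantsHypothesis.ValiantsHypothesis.Theorems.SymPencilPerFourHessianMinors
open Summit.ValiantsHypothesis.ValiantsHypothesis.Theorems.SymPencilPerFourHessianRankThreeProp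
open Summit.ValiantsHypothesis.ValiantsHypothesis.Theorems.SymPencilPerFourHessianRankThreeZero
open Summit.ValiantsHypothesis.ValiantsHypothesis.Theorems.SymPencilPerFourHessianToric
open Summit.ValiantsHypothesis.ValiantsHypothesis.Theorems.SymPencilPerFourToricLever
open Summit.ValiantsHypothesis.ValiantsHypothesis.Theorems.SymPencilPerFourToricZeroRow
open Summit.ValiantsHypothesis.ValiantsHypothesis.Theorems.SymPencilPerFourToricLowRank
open Summit.ValiantsHypothesis.ValiantsHypothesis.Theorems.SymPencilPerFourToricTwoRow
open Summit.ValiantsHypothesis.ValiantsHypothesis.Theorems.SymPencilPerFourToricEqualSplit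
open Summit.ValiantsHypothesis.ValiantsHypothesis.Theorems.SymPencilPerFourToricSingleRow

variable {K : Type*} [Field K]

set_option maxHeartbeats 1600000 in
/-- **CASE 1 of the toric case: two rows with the same image are impossible.**  See the module
docstring. [folklore] -/
theorem false_of_rows_eq [CharZero K] (W : Submodule K (Fin 4 × Fin 4 → K))
    (hW3 : ∀ x ∈ W, ∀ (r c : Fin 3 → Fin 4), Function.Injective r → Function.Injective c →
      ((Matrix.of fun i j => x (i, j)).submatrix r c).permanent = 0)
    (hcol : ∀ l : Fin 4, finrank K (W.map (LinearMap.funLeft K K fun i : Fin 4 => (i, l))) ≤ 2)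
    (h6 : finrank K W = 6)
    (hn2 : ∀ r : Fin 4, finrank K (W.map (LinearMap.funLeft K K fun j : Fin 4 => (r, j))) = 2)
    (q q' : Fin 4) (hqq' : q ≠ q')
    (hL : W.map (LinearMap.funLeft K K fun j : Fin 4 => (q, j)) =
      W.map (LinearMap.funLeft K K fun j : Fin 4 => (q', j))) : False := by
  classical
  have hrow : ∀ r : Fin 4, finrank K (W.map (LinearMap.funLeft K K fun j : Fin 4 => (r, j))) ≤ 2 :=
    fun r => (hn2 r).le
  obtain ⟨p, p', hpp', hpq, hpq', hp'q, hp'q', hrows⟩ := exists_other_two q q' hqq'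
  have dX : finrank K W ≤ _ := finrank_pair_le W q q'
  have dT := finrank_single_row_le W p' q q' p hp'q hp'q' hpp'.symm hqq' hpq.symm hpq'.symm
  set ρp := (LinearMap.funLeft K K fun j : Fin 4 => (p, j)) with hρp
  set ρp' := (LinearMap.funLeft K K fun j : Fin 4 => (p', j)) with hρp'
  set ρq := (LinearMap.funLeft K K fun j : Fin 4 => (q, j)) with hρq
  set ρq' := (LinearMap.funLeft K K fun j : Fin 4 => (q', j)) with hρq'
  have eρp : ∀ (x : Fin 4 × Fin 4 → K) (j : Fin 4), ρp x j = x (p, j) := fun _ _ => rfl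
  have eρp' : ∀ (x : Fin 4 × Fin 4 → K) (j : Fin 4), ρp' x j = x (p', j) := fun _ _ => rfl
  have eρq : ∀ (x : Fin 4 × Fin 4 → K) (j : Fin 4), ρq x j = x (q, j) := fun _ _ => rfl
  have eρq' : ∀ (x : Fin 4 × Fin 4 → K) (j : Fin 4), ρq' x j = x (q', j) := fun _ _ => rfl
  have eγ : ∀ (l : Fin 4) (x : Fin 4 × Fin 4 → K) (i : Fin 4),
      (LinearMap.funLeft K K fun i : Fin 4 => (i, l)) x i = x (i, l) := fun _ _ _ => rfl
  have hnp : finrank K (W.map ρp) = 2 := hn2 p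
  have hnp' : finrank K (W.map ρp') = 2 := hn2 p'
  have hnq : finrank K (W.map ρq) = 2 := hn2 q
  have hnq'2 : finrank K (W.map ρq') = 2 := hn2 q'
  set X := W ⊓ LinearMap.ker ρq ⊓ LinearMap.ker ρq' with hXdef
  have memX : ∀ x, x ∈ X ↔ x ∈ W ∧ (∀ j, x (q, j) = 0) ∧ ∀ j, x (q', j) = 0 := fun x => by
    rw [hXdef]; exact mem_pair_iff W q q' x
  have hX2 : 2 ≤ finrank K X := by omega
  have hX4 : finrank K X ≤ 4 := by
    have h := finrank_eq_finrank_map_add_finrank_inf_ker X ρp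
    have m : finrank K (X.map ρp) ≤ 2 :=
      (Submodule.finrank_mono (Submodule.map_mono (inf_le_left.trans inf_le_left))).trans (hrow p)
    have hT : finrank K ↥(X ⊓ LinearMap.ker ρp) ≤ finrank K (W.map ρp') := dT
    omega
  have hXrows : ∀ x ∈ X, ∀ i j : Fin 4, i ≠ p → i ≠ p' → x (i, j) = 0 := by
    intro x hx i j hip hip'
    obtain ⟨-, hxq, hxq'⟩ := (memX x).1 hx
    rcases hrows i with hi | hi | hi | hi
    exacts [by rw [hi]; exact hxq j, by rw [hi]; exact hxq' j, absurd hi hip, absurd hi hip']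
  have mXp : finrank K (X.map ρp) ≤ 2 :=
    (Submodule.finrank_mono (Submodule.map_mono (inf_le_left.trans inf_le_left))).trans (hrow p)
  have mXp' : finrank K (X.map ρp') ≤ 2 :=
    (Submodule.finrank_mono (Submodule.map_mono (inf_le_left.trans inf_le_left))).trans (hrow p')
  set Wq := W ⊓ LinearMap.ker ρq with hWq
  have hWq4 : finrank K Wq = 4 := by
    have := finrank_eq_finrank_map_add_finrank_inf_ker W ρq
    rw [← hWq] at this; omega
  have hXWq : X ≤ Wq := inf_le_left
  -- column-rank lemma: a column live in rows `q` (at `y`), `q'` (at `y²` with `y²_{qj} = 0`) is dead on `X`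
  have hdead : ∀ j, ∀ y ∈ W, y (q, j) ≠ 0 → ∀ y₂ ∈ W, y₂ (q, j) = 0 → y₂ (q', j) ≠ 0 →
      ∀ x ∈ X, x (p, j) = 0 ∧ x (p', j) = 0 := by
    intro j y hy hyj y₂ hy₂ hy₂q hy₂j x hx
    obtain ⟨hxW, hxq, hxq'⟩ := (memX x).1 hx
    set γ := (LinearMap.funLeft K K fun i : Fin 4 => (i, j)) with hγ
    have eγ' : ∀ (z : Fin 4 × Fin 4 → K) (i : Fin 4), γ z i = z (i, j) := fun _ _ => rfl
    have hcj : finrank K (W.map γ) ≤ 2 := hcol j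
    -- for either row `r ∈ {p, p'}` a non-zero entry gives three independent columns
    have key : ∀ r, (r = p ∨ r = p') → x (r, j) = 0 := by
      intro r hr
      by_contra hxr
      have hrq : r ≠ q := by rcases hr with h | h <;> rw [h]; exacts [hpq, hp'q]
      have hrq' : r ≠ q' := by rcases hr with h | h <;> rw [h]; exacts [hpq', hp'q']
      have hli : LinearIndependent K ![γ y, γ y₂, γ x] := by
        rw [Fintype.linearIndependent_iff]
        intro g hg i
        have hsum : g 0 • γ y + g 1 • γ y₂ + g 2 • γ x = 0 := by
          rw [Fin.sum_univ_three] at hg; simpa using hg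
        have cq : (g 0 • γ y + g 1 • γ y₂ + g 2 • γ x) q = 0 := by rw [hsum]; rfl
        have cq' : (g 0 • γ y + g 1 • γ y₂ + g 2 • γ x) q' = 0 := by rw [hsum]; rfl
        have cr : (g 0 • γ y + g 1 • γ y₂ + g 2 • γ x) r = 0 := by rw [hsum]; rfl
        simp only [Pi.add_apply, Pi.smul_apply, smul_eq_mul, eγ', hy₂q, hxq j, mul_zero,
          add_zero] at cq
        have g0 : g 0 = 0 := (mul_eq_zero.1 cq).resolve_right hyj
        simp only [Pi.add_apply, Pi.smul_apply, smul_eq_mul, eγ', g0, zero_mul, zero_add,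
          hxq' j, mul_zero, add_zero] at cq'
        have g1 : g 1 = 0 := (mul_eq_zero.1 cq').resolve_right hy₂j
        simp only [Pi.add_apply, Pi.smul_apply, smul_eq_mul, eγ', g0, g1, zero_mul,
          zero_add] at cr
        have g2 : g 2 = 0 := (mul_eq_zero.1 cr).resolve_right hxr
        fin_cases i <;> assumption
      have hle : Submodule.span K (Set.range ![γ y, γ y₂, γ x]) ≤ W.map γ := by
        rw [Submodule.span_le]
        rintro _ ⟨i, rfl⟩
        fin_cases i; exacts [⟨y, hy, rfl⟩, ⟨y₂, hy₂, rfl⟩, ⟨x, hxW, rfl⟩]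
      have := Submodule.finrank_mono hle
      rw [finrank_span_eq_card hli, Fintype.card_fin] at this
      omega
    exact ⟨key p (Or.inl rfl), key p' (Or.inr rfl)⟩
  -- the lever with a row value `u₂ = ρq' y₂` whose support is dead on `X` kills all perms of `X`
  have hallperm : ∀ y₂ ∈ W, (∀ j, y₂ (q, j) = 0) → (fun j => y₂ (q', j)) ≠ 0 →
      (∀ j, y₂ (q', j) ≠ 0 → ∀ x ∈ X, x (p, j) = 0 ∧ x (p', j) = 0) →
      ∀ x ∈ X, ∀ l l' : Fin 4, l ≠ l' → x (p, l) * x (p', l') + x (p, l') * x (p', l) = 0 := by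
    intro y₂ hy₂ hy₂q hu₂ hdj x hx l l' hll'
    obtain ⟨hxW, hxq, hxq'⟩ := (memX x).1 hx
    by_cases hl : y₂ (q', l) ≠ 0
    · obtain ⟨h1, h2⟩ := hdj l hl x hx; rw [h1, h2]; ring
    by_cases hl' : y₂ (q', l') ≠ 0
    · obtain ⟨h1, h2⟩ := hdj l' hl' x hx; rw [h1, h2]; ring
    push Not at hl hl'
    obtain ⟨k, k', hkk', hkl, hkl', hk'l, hk'l', hall⟩ := exists_other_two l l' hll'
    have e1 := pair_lever W hW3 hxW hy₂ hpp' hpq' hp'q' hxq' hkl hkl' hll'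
    have e2 := pair_lever W hW3 hxW hy₂ hpp' hpq' hp'q' hxq' hk'l hk'l' hll'
    rw [hl, hl', zero_mul, zero_mul, add_zero, add_zero] at e1 e2
    by_contra hne
    have h1 : y₂ (q', k) = 0 := (mul_eq_zero.1 e1).resolve_right hne
    have h2 : y₂ (q', k') = 0 := (mul_eq_zero.1 e2).resolve_right hne
    exact hu₂ (funext fun m => by
      rcases hall m with hm | hm | hm | hm <;> rw [hm]; exacts [hl, hl', h1, h2])
  -- Step 1: `dim X ≤ 3` forces `dim X ≤ 2`
  have hX_le : finrank K X ≤ 3 → finrank K X ≤ 2 := by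
    intro h3
    have hne : X ≠ Wq := fun h => by rw [h] at h3; omega
    obtain ⟨y₂, hy₂Wq, hy₂X⟩ : ∃ y₂ ∈ Wq, y₂ ∉ X := by
      by_contra h; push Not at h
      exact hne (le_antisymm hXWq h)
    obtain ⟨hy₂W, hy₂q⟩ := Submodule.mem_inf.1 hy₂Wq
    rw [LinearMap.mem_ker] at hy₂q
    have hy₂q' : ∀ j, y₂ (q, j) = 0 := fun j => by have := congr_fun hy₂q j; rwa [eρq] at this
    have hu₂ : (fun j => y₂ (q', j)) ≠ 0 := by
      intro h
      exact hy₂X ((memX y₂).2 ⟨hy₂W, hy₂q', fun j => congr_fun h j⟩)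
    -- live columns of `u₂` are dead on `X`
    have hdj : ∀ j, y₂ (q', j) ≠ 0 → ∀ x ∈ X, x (p, j) = 0 ∧ x (p', j) = 0 := by
      intro j hj
      have : ρq' y₂ ∈ W.map ρq := by rw [hL]; exact ⟨y₂, hy₂W, rfl⟩
      obtain ⟨y, hy, hyy⟩ := this
      have hyj : y (q, j) ≠ 0 := by rw [← eρq y j, hyy, eρq']; exact hj
      exact hdead j y hy hyj y₂ hy₂W (hy₂q' j) hj
    exact finrank_le_two_of_perms_vanish X p p' hXrows (hallperm y₂ hy₂W hy₂q' hu₂ hdj) mXp mXp'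
  -- so `dim X = 2` (the case `dim X = 4` is `false_of_rows_eq_split`)
  have hXeq : finrank K X = 2 := by
    by_cases h4 : finrank K X = 4
    · exact (false_of_rows_eq_split W hW3 hcol h6 hn2 p p' q q' hpp' hpq hpq' hp'q hp'q' hqq' h4).elim
    · have := hX_le (by omega); omega
  -- Step 2: rows `q, q'` are jointly free
  have free_q' : ∀ u ∈ W.map ρq', ∃ y ∈ W, (∀ j, y (q, j) = 0) ∧ ∀ j, y (q', j) = u j := by
    have h := finrank_eq_finrank_map_add_finrank_inf_ker Wq ρq'
    have hXX : Wq ⊓ LinearMap.ker ρq' = X := rfl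
    rw [hXX, hWq4, hXeq] at h
    have heq : Wq.map ρq' = W.map ρq' :=
      Submodule.eq_of_le_of_finrank_le (Submodule.map_mono inf_le_left) (by rw [hnq'2]; omega)
    intro u hu
    rw [← heq] at hu
    obtain ⟨y, hy, rfl⟩ := hu
    obtain ⟨hyW, hyq⟩ := Submodule.mem_inf.1 hy
    rw [LinearMap.mem_ker] at hyq
    exact ⟨y, hyW, fun j => by have := congr_fun hyq j; rwa [eρq] at this, fun j => rfl⟩
  have free_q : ∀ u ∈ W.map ρq, ∃ y ∈ W, (∀ j, y (q', j) = 0) ∧ ∀ j, y (q, j) = u j := by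
    set Wq' := W ⊓ LinearMap.ker ρq' with hWq'
    have hWq'4 : finrank K Wq' = 4 := by
      have := finrank_eq_finrank_map_add_finrank_inf_ker W ρq'
      rw [← hWq'] at this; omega
    have h := finrank_eq_finrank_map_add_finrank_inf_ker Wq' ρq
    have hXX : Wq' ⊓ LinearMap.ker ρq = X := by
      rw [hWq', hXdef, inf_assoc, inf_assoc, inf_comm (LinearMap.ker ρq') (LinearMap.ker ρq)]
    rw [hXX, hWq'4, hXeq] at h
    have heq : Wq'.map ρq = W.map ρq :=
      Submodule.eq_of_le_of_finrank_le (Submodule.map_mono inf_le_left) (by rw [hnq]; omega)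
    intro u hu
    rw [← heq] at hu
    obtain ⟨y, hy, rfl⟩ := hu
    obtain ⟨hyW, hyq⟩ := Submodule.mem_inf.1 hy
    rw [LinearMap.mem_ker] at hyq
    exact ⟨y, hyW, fun j => by have := congr_fun hyq j; rwa [eρq'] at this, fun j => rfl⟩
  -- live columns of `L` are dead on `X`
  have hliveX : ∀ j, (∃ y ∈ W, y (q, j) ≠ 0) → ∀ x ∈ X, x (p, j) = 0 ∧ x (p', j) = 0 := by
    rintro j ⟨y, hy, hyj⟩
    have : ρq y ∈ W.map ρq' := by rw [← hL]; exact ⟨y, hy, rfl⟩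
    obtain ⟨y₂, hy₂, hy₂q, hy₂r⟩ := free_q' _ this
    refine hdead j y hy hyj y₂ hy₂ (hy₂q j) ?_
    rw [hy₂r, eρq]; exact hyj
  -- rows `q, q'` are dead at the same columns
  have hdeadq' : ∀ k, (∀ y ∈ W, y (q, k) = 0) → ∀ y ∈ W, y (q', k) = 0 := by
    intro k hk y hy
    have : ρq' y ∈ W.map ρq := by rw [hL]; exact ⟨y, hy, rfl⟩
    obtain ⟨y', hy', hyy⟩ := this
    rw [← eρq' y k, ← hyy, eρq]; exact hk y' hy'
  -- Step 3: case analysis on the dead columns of `L`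
  by_cases h2dead : ∃ c d : Fin 4, c ≠ d ∧ (∀ y ∈ W, y (q, c) = 0) ∧ ∀ y ∈ W, y (q, d) = 0
  · obtain ⟨c, d, hcd, hc, hd⟩ := h2dead
    obtain ⟨a, b, hab, hac, had, hbc, hbd, hcols⟩ := exists_other_two c d hcd
    -- `e_a, e_b ∈ L`
    have hLab : ∀ v ∈ W.map ρq, ∀ m, m ≠ a → m ≠ b → v m = 0 := by
      rintro _ ⟨y, hy, rfl⟩ m hma hmb
      rw [eρq]
      rcases hcols m with hm | hm | hm | hm
      exacts [by rw [hm]; exact hc y hy, by rw [hm]; exact hd y hy, absurd hm hma, absurd hm hmb]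
    have hea : (Pi.single a (1 : K) : Fin 4 → K) ∈ W.map ρq :=
      mem_of_le_pair_of_finrank _ a b hLab (by rw [hnq]) _ (fun m hma _ => Pi.single_eq_of_ne hma _)
    have heb : (Pi.single b (1 : K) : Fin 4 → K) ∈ W.map ρq' := by
      rw [← hL]
      exact mem_of_le_pair_of_finrank _ a b hLab (by rw [hnq]) _ (fun m _ hmb => Pi.single_eq_of_ne hmb _)
    obtain ⟨ya, hya, hyaq', hyaq⟩ := free_q _ hea
    obtain ⟨yb, hyb, hybq, hybq'⟩ := free_q' _ heb
    -- the product identity from H3: `w_{p̃ k} · per(w; q q'; a b) = 0` on `W`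
    have hprod : ∀ r, (r = p ∨ r = p') → ∀ k, (k = c ∨ k = d) → ∀ w ∈ W,
        w (r, k) * (w (q, a) * w (q', b) + w (q, b) * w (q', a)) = 0 := by
      intro r hr k hk w hw
      have hrq : r ≠ q := by rcases hr with h | h <;> rw [h]; exacts [hpq, hp'q]
      have hrq' : r ≠ q' := by rcases hr with h | h <;> rw [h]; exacts [hpq', hp'q']
      have hka : k ≠ a := by rcases hk with h | h <;> rw [h]; exacts [hac.symm, had.symm]
      have hkb : k ≠ b := by rcases hk with h | h <;> rw [h]; exacts [hbc.symm, hbd.symm]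
      have hwqk : w (q, k) = 0 := by rcases hk with h | h <;> rw [h]; exacts [hc w hw, hd w hw]
      have hwq'k : w (q', k) = 0 := by
        rcases hk with h | h <;> rw [h]
        exacts [hdeadq' c hc w hw, hdeadq' d hd w hw]
      have hinjr : Function.Injective ![r, q, q'] := injective_vec_three hrq hrq' hqq'
      have hinjc : Function.Injective ![k, a, b] := injective_vec_three hka hkb hab
      have h := hW3 w hw ![r, q, q'] ![k, a, b] hinjr hinjc
      rw [Matrix.permanent_fin_three_row] at h
      simp only [Matrix.submatrix_apply, Matrix.of_apply, Matrix.cons_val_zero, Matrix.cons_val_one,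
        Matrix.cons_val, hwqk, hwq'k, mul_zero, zero_mul, add_zero] at h
      linear_combination h
    have hrk : ∀ r, (r = p ∨ r = p') → ∀ k, (k = c ∨ k = d) → ∀ w ∈ W, w (r, k) = 0 := by
      intro r hr k hk
      rcases forall_eq_zero_or_of_mul₂ W (linePoly_cell (r, k))
        (linePoly_perm_two (q, a) (q', b) (q, b) (q', a)) (hprod r hr k hk) with h | h
      · exact h
      · exfalso
        have e := h (ya + yb) (W.add_mem hya hyb)
        simp only [Pi.add_apply, hyaq, hybq, hyaq', hybq', Pi.single_eq_same,
          Pi.single_eq_of_ne hab, Pi.single_eq_of_ne hab.symm, add_zero, zero_add, mul_one,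
          mul_zero] at e
        exact one_ne_zero e
    -- so `X = 0`
    have hX0 : X = ⊥ := by
      rw [Submodule.eq_bot_iff]
      intro x hx
      obtain ⟨hxW, -, -⟩ := (memX x).1 hx
      have hla : ∃ y ∈ W, y (q, a) ≠ 0 := ⟨ya, hya, by rw [hyaq, Pi.single_eq_same]; exact one_ne_zero⟩
      have hlb : ∃ y ∈ W, y (q, b) ≠ 0 := by
        obtain ⟨y, hy, hyy⟩ := (show (Pi.single b (1 : K) : Fin 4 → K) ∈ W.map ρq from
          mem_of_le_pair_of_finrank _ a b hLab (by rw [hnq]) _ (fun m _ hmb => Pi.single_eq_of_ne hmb _))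
        exact ⟨y, hy, by rw [← eρq y b, hyy, Pi.single_eq_same]; exact one_ne_zero⟩
      funext e; obtain ⟨i, m⟩ := e
      by_cases hip : i = p
      · rw [hip]
        rcases hcols m with hm | hm | hm | hm <;> rw [hm]
        · exact hrk p (Or.inl rfl) c (Or.inl rfl) x hxW
        · exact hrk p (Or.inl rfl) d (Or.inr rfl) x hxW
        · exact (hliveX a hla x hx).1
        · exact (hliveX b hlb x hx).1
      by_cases hip' : i = p'
      · rw [hip']
        rcases hcols m with hm | hm | hm | hm <;> rw [hm]
        · exact hrk p' (Or.inr rfl) c (Or.inl rfl) x hxW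
        · exact hrk p' (Or.inr rfl) d (Or.inr rfl) x hxW
        · exact (hliveX a hla x hx).2
        · exact (hliveX b hlb x hx).2
      exact hXrows x hx i m hip hip'
    rw [hX0, finrank_bot] at hXeq
    exact absurd hXeq (by norm_num)
  · push Not at h2dead
    by_cases h1dead : ∃ k, ∀ y ∈ W, y (q, k) = 0
    · obtain ⟨k, hk⟩ := h1dead
      have hlive : ∀ m, m ≠ k → ∃ y ∈ W, y (q, m) ≠ 0 := fun m hmk => h2dead k m (Ne.symm hmk) hk
      -- `X ⊆ ⟨E_{pk}, E_{p'k}⟩`, hence equal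
      set S : Submodule K (Fin 4 × Fin 4 → K) :=
        Submodule.span K (Set.range ![(Pi.single (p, k) (1 : K) : Fin 4 × Fin 4 → K),
          Pi.single (p', k) 1]) with hS
      have hli : LinearIndependent K ![(Pi.single (p, k) (1 : K) : Fin 4 × Fin 4 → K),
          Pi.single (p', k) 1] := by
        have h := (Pi.basisFun K (Fin 4 × Fin 4)).linearIndependent
        have h' : LinearIndependent K (⇑(Pi.basisFun K (Fin 4 × Fin 4)) ∘ ![(p, k), (p', k)]) :=
          h.comp _ (by
            intro i i' hii'
            fin_cases i <;> fin_cases i'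
            · rfl
            · exact absurd (Prod.mk.inj hii').1 hpp'
            · exact absurd (Prod.mk.inj hii').1 hpp'.symm
            · rfl)
        convert h' using 1
        ext i : 1
        fin_cases i <;> simp
      have hS2 : finrank K S = 2 := by rw [hS, finrank_span_eq_card hli, Fintype.card_fin]
      have hXS : X ≤ S := by
        intro x hx
        have hdec : x = x (p, k) • (Pi.single (p, k) (1 : K) : Fin 4 × Fin 4 → K) +
            x (p', k) • Pi.single (p', k) 1 := by
          funext e; obtain ⟨i, m⟩ := e
          simp only [Pi.add_apply, Pi.smul_apply, smul_eq_mul]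
          by_cases hik : (i, m) = (p, k)
          · rw [hik, Pi.single_eq_same, Pi.single_eq_of_ne (fun h => hpp' (Prod.mk.inj h).1)]
            ring
          by_cases hik' : (i, m) = (p', k)
          · rw [hik', Pi.single_eq_same, Pi.single_eq_of_ne (fun h => hpp' (Prod.mk.inj h).1.symm)]
            ring
          rw [Pi.single_eq_of_ne hik, Pi.single_eq_of_ne hik', mul_zero, mul_zero, add_zero]
          by_cases hip : i = p
          · have hmk : m ≠ k := fun h => hik (by rw [hip, h])
            rw [hip]; exact (hliveX m (hlive m hmk) x hx).1
          by_cases hip' : i = p'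
          · have hmk : m ≠ k := fun h => hik' (by rw [hip', h])
            rw [hip']; exact (hliveX m (hlive m hmk) x hx).2
          exact hXrows x hx i m hip hip'
        rw [hdec, hS]
        refine Submodule.add_mem _ (Submodule.smul_mem _ _ (Submodule.subset_span ⟨0, rfl⟩))
          (Submodule.smul_mem _ _ (Submodule.subset_span ⟨1, rfl⟩))
      have hXeqS : X = S := Submodule.eq_of_le_of_finrank_le hXS (by rw [hS2, hXeq])
      have hunit : (Pi.single (p, k) (1 : K) : Fin 4 × Fin 4 → K) ∈ W := by
        have : (Pi.single (p, k) (1 : K) : Fin 4 × Fin 4 → K) ∈ X := by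
          rw [hXeqS, hS]; exact Submodule.subset_span ⟨0, rfl⟩
        exact ((memX _).1 this).1
      -- `L ⊥ L`
      have horth : ∀ u ∈ W.map ρq, ∀ u' ∈ W.map ρq, ∀ m m' : Fin 4, m ≠ m' →
          u m * u' m' + u m' * u' m = 0 := by
        intro u hu u' hu' m m' hmm'
        have hu'' : u' ∈ W.map ρq' := by rw [← hL]; exact hu'
        obtain ⟨y₁, hy₁, hy₁q', hy₁q⟩ := free_q u hu
        obtain ⟨y₂, hy₂, hy₂q, hy₂q'⟩ := free_q' u' hu''
        by_cases hmk : m = k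
        · have h1 : u m = 0 := by
            obtain ⟨y, hy, rfl⟩ := hu; rw [eρq, hmk]; exact hk y hy
          have h2 : u' m = 0 := by
            obtain ⟨y, hy, rfl⟩ := hu'; rw [eρq, hmk]; exact hk y hy
          rw [h1, h2]; ring
        by_cases hm'k : m' = k
        · have h1 : u m' = 0 := by
            obtain ⟨y, hy, rfl⟩ := hu; rw [eρq, hm'k]; exact hk y hy
          have h2 : u' m' = 0 := by
            obtain ⟨y, hy, rfl⟩ := hu'; rw [eρq, hm'k]; exact hk y hy
          rw [h1, h2]; ring
        have e := perm_two_of_unit W hW3 hunit hpq.symm hpq'.symm hqq' hmk hm'k hmm'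
          (W.add_mem hy₁ hy₂)
        simp only [Pi.add_apply, hy₁q, hy₁q', hy₂q, hy₂q', add_zero, zero_add] at e
        exact e
      have hL0 := eq_zero_of_bilinear_perm_orth (W.map ρq) (W.map ρq) horth (by rw [hnq])
      have : W.map ρq = ⊥ := by rw [Submodule.eq_bot_iff]; exact hL0
      rw [this, finrank_bot] at hnq
      exact absurd hnq (by norm_num)
    · push Not at h1dead
      -- every column is live: `X = 0`
      have hX0 : X = ⊥ := by
        rw [Submodule.eq_bot_iff]
        intro x hx
        funext e; obtain ⟨i, m⟩ := e
        obtain ⟨y, hy, hym⟩ := h1dead m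
        by_cases hip : i = p
        · rw [hip]; exact (hliveX m ⟨y, hy, hym⟩ x hx).1
        by_cases hip' : i = p'
        · rw [hip']; exact (hliveX m ⟨y, hy, hym⟩ x hx).2
        exact hXrows x hx i m hip hip'
      rw [hX0, finrank_bot] at hXeq
      exact absurd hXeq (by norm_num)

end Summit.ValiantsHypothesis.ValiantsHypothesis.Theorems.SymPencilPerFourToricEqualRows

end
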